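import Mathlib
import Literature.Combinatorics.Additive.TPPGroupAlgebra

/-!
# The reversed triple `(U, T, S)` and its transposed quotient profiles

Crux `Summit.MatrixMultiplication.MatrixMultiplication.Theses.SnSubsetDichotomy.PolynomialSlack`
(item `stmt-MatrixMultiplication-8306`), level-one programme, line transport-split-hull (lead c10).
The triple product property is invariant under REVERSAL `(S, T, U) ↦ (U, T, S)` (invert the defining
relation `s s'⁻¹ t t'⁻¹ u u'⁻¹ = 1`), and the three quotient profiles of the reversed triple are the
TRANSPOSES of those of the original with the roles of `A = S⁻¹T` and `B = T⁻¹U` exchanged: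
`d_{A°}(i,j) = d_B(j,i)`, `d_{B°}(j,k) = d_A(k,j)`, `d_{C°}(k,i) = d_C(i,k)` (swap the factors of the
counting sets).  The 3/4 step runs c9's per-position atom chain at the hub COLUMNS of the sparse profile
`d_C` by applying it verbatim to the reversed triple.
-/

set_option linter.dupNamespace false

open scoped BigOperators

namespace Summit.MatrixMultiplication.MatrixMultiplication.Theorems.PolynomialSlack

open Literature.Combinatorics.Additive (TripleProductProperty)

/-- **Reversal symmetry of the TPP.** `TPP(S, T, U) → TPP(U, T, S)`: if
`u u'⁻¹ (t t'⁻¹) (s s'⁻¹) = 1` then, inverting, `s' s⁻¹ (t' t⁻¹) (u' u⁻¹) = 1`, an instance of the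
original relation with the primed and unprimed elements exchanged. [folklore] -/
theorem tpp_reverse {G : Type*} [Group G] {S T U : Finset G} (h : TripleProductProperty S T U) :
    TripleProductProperty U T S := by
  intro u hu u' hu' t ht t' ht' s hs s' hs' heq
  have heq' : s' * s⁻¹ * (t' * t⁻¹) * (u' * u⁻¹) = 1 :=
    calc s' * s⁻¹ * (t' * t⁻¹) * (u' * u⁻¹)
        = (u * u'⁻¹ * (t * t'⁻¹) * (s * s'⁻¹))⁻¹ := by group
      _ = 1 := by rw [heq, inv_one]
  obtain ⟨hs1, ht1, hu1⟩ := h s' hs' s hs t' ht' t ht u' hu' u hu heq'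
  exact ⟨hu1.symm, ht1.symm, hs1.symm⟩

/-- **Transposed counting sets.** For finite `X, Y ⊆ S_n` and positions/values `i, j`:
`#{(x, y) ∈ X × Y : y j = x i} = #{(y, x) ∈ Y × X : x i = y j}` (swap the factors). [folklore] -/
theorem card_filter_prod_swap {n : ℕ} (X Y : Finset (Equiv.Perm (Fin n))) (i j : Fin n) :
    ((X ×ˢ Y).filter fun xy => xy.2 j = xy.1 i).card =
      ((Y ×ˢ X).filter fun yx => yx.2 i = yx.1 j).card := by
  refine Finset.card_equiv (Equiv.prodComm _ _) fun xy => ?_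
  simp only [Finset.mem_filter, Finset.mem_product, Equiv.prodComm_apply, Prod.fst_swap,
    Prod.snd_swap]
  exact ⟨fun ⟨⟨hx, hy⟩, h⟩ => ⟨⟨hy, hx⟩, h.symm⟩, fun ⟨⟨hy, hx⟩, h⟩ => ⟨⟨hx, hy⟩, h.symm⟩⟩

/-- **Profiles of the reversed triple.** With `dA, dB, dC` the quotient profiles of `(S, T, U)`
(as in the programme: `dA i j = #{(s,t) : t j = s i}/(|S||T|)`, `dB j k = #{(t,u) : u k = t j}/(|T||U|)`,
`dC k i = #{(u,s) : s i = u k}/(|U||S|)`), the profiles of the reversed triple `(U, T, S)` are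
`dA° i j := dB j i`, `dB° j k := dA k j`, `dC° k i := dC i k`, i.e. they satisfy the defining formulas
for `(U, T, S)`. [folklore] -/
theorem reversed_profiles {n : ℕ} (S T U : Finset (Equiv.Perm (Fin n))) (dA dB dC : Fin n → Fin n → ℝ)
    (hdA : ∀ i j, dA i j =
      (((S ×ˢ T).filter fun st => st.2 j = st.1 i).card : ℝ) / (S.card * T.card : ℕ))
    (hdB : ∀ j k, dB j k =
      (((T ×ˢ U).filter fun tu => tu.2 k = tu.1 j).card : ℝ) / (T.card * U.card : ℕ))
    (hdC : ∀ k i, dC k i =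
      (((U ×ˢ S).filter fun us => us.2 i = us.1 k).card : ℝ) / (U.card * S.card : ℕ)) :
    (∀ i j, dB j i =
      (((U ×ˢ T).filter fun ut => ut.2 j = ut.1 i).card : ℝ) / (U.card * T.card : ℕ)) ∧
    (∀ j k, dA k j =
      (((T ×ˢ S).filter fun ts => ts.2 k = ts.1 j).card : ℝ) / (T.card * S.card : ℕ)) ∧
    (∀ k i, dC i k =
      (((S ×ˢ U).filter fun su => su.2 i = su.1 k).card : ℝ) / (S.card * U.card : ℕ)) := by
  refine ⟨fun i j => ?_, fun j k => ?_, fun k i => ?_⟩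
  · rw [hdB j i, card_filter_prod_swap T U j i, Nat.mul_comm]
  · rw [hdA k j, card_filter_prod_swap S T k j, Nat.mul_comm]
  · rw [hdC i k, card_filter_prod_swap U S i k, Nat.mul_comm]

end Summit.MatrixMultiplication.MatrixMultiplication.Theorems.PolynomialSlack
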